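import Mathlib
import HarnessLib
import Summits.HubbardSuperconductivity.HubbardSuperconductivity.Theorems.KLProgrammeKLRegimeCountertermJacksonRemainderCertFrame

/-!
# Route `KLProgramme`, crux K3 — gen-8 ENGINE-FLOW child (stmt-HubbardSuperconductivity-20437 `KLRegimeEngineV17F2`), stub (C)
# `stub_twoLeg_curvature`: the (C1) certificate consumer for a `C⁴` HISTORY — core (a.e. chain bounds + abstract top increment)

Seat hubbard-kl-k3c3-p1 (g8; row «δμ-flow with klAngularMean constant piece»).  The consumers of record
(`flowPiece_reading_remainder_jets_of_majorants` / `…_of_certFrame`, p560402; `…_value_of_cert`, p558812) ask `hf : ContDiff ℝ 5 ν_n(K_n)`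
and profile sizes `a l, l ≤ 5`: the top-order transport increment `χ_w·(g⁽ᵏ⁾(α_w θ) − g⁽ᵏ⁾(θ))` is charged by the mean-value RATE row
`a_{k+1}·Td`.  Stub (C)'s induction hypothesis `TwoLegReadJetBound … K_n n` is `C⁴` with jets `k ≤ 4` (c4a-1 (I2): «the chain rule along γ
caps at order 4»; k3c3-p3 `C1-JETBOX-DEEP.md` §4.2), so at `k = 4` those consumers cannot be called from the history.  This file is the
core of the `C⁴`-history consumers (`…CertFrameHistC4` has the frame-quantified rate / no-rate / value forms):

* §1 `ae_jmeas_chain_bounds_certAngle_C4` — the `C⁴` twin of `ae_jmeas_chain_bounds_certAngle` (p556637): a.e. in the displacement, the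
  graded chain bound (`k ≤ 4`), the RAW transport form (`+ |g⁽ᵏ⁾(α_w θ) − g⁽ᵏ⁾(t)|`), the RATE transport rows for `k ≤ 3` (`a_{k+1}`, `k+1 ≤ 4`),
  the NO-RATE transport rows for `k ≤ 4` (`+ 2a_k`) and the value row (`a₁`);
* §2 **`flowPiece_reading_remainder_jets_of_majorants_top`** — the assembly core of p560402 with the top-order increment majorant ABSTRACT
  (`|χ_w(θ)|·|g⁽ᵏ⁾(α_w θ) − g⁽ᵏ⁾(θ)| ≤ ι w` a.e., `∫J̃J̃·ι ≤ I`) under `ContDiff ℝ 4` + `a l, l ≤ 4`; the bound is the door's sum with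
  transport moment `Σ_{l<k} a_l·Tt[k,l] + a_k·Tu[k] + I` (`1 ≤ k ≤ 4`).

Pure assembly (real analysis bookkeeping); no definitions; nothing here asserts superconductivity.
-/

noncomputable section

namespace Summit.HubbardSuperconductivity.HubbardSuperconductivity.Theorems.KLRegimeSplit

set_option linter.dupNamespace false -- summit = problem name (single-conjunct summit), D-0017

open Real MeasureTheory Filter Set
open scoped Topology
open Literature.Analysis.Fourier.TrigApprox Literature.MathematicalPhysics.QuantumLattice
open Summit.HubbardSuperconductivity.HubbardSuperconductivity.Theorems.PerturbedFermiCurve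

/-! ## §1 The a.e. chain bounds of the displaced angular factor for a `C⁴` profile -/

section ChainAE

variable {r g : ℝ → ℝ} {a : ℕ → ℝ}

/-- **A.e. chain bounds, `C⁴` profile.**  For `r ∈ C⁴`, a `2π`-periodic `g ∈ C⁴` with `|g^{(l)}| ≤ a l` (`1 ≤ l ≤ 4`), and every base angle
`θ`: for a.e. displacement `w`, `ϑ ↦ g(α_w(ϑ))` is `C⁴` at `θ`; `|∂ᵏ(g∘α_w)(θ)| ≤ Σ_{1≤l≤k} a_l·P_{k,l}(X_w)` (`1 ≤ k ≤ 4`); for every reference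
`t` the RAW transport form `|∂ᵏ(g∘α_w)(θ) − g⁽ᵏ⁾(t)| ≤ Σ_{1≤l<k} a_l·P_{k,l}(X_w) + a_k·|α_w′(θ)ᵏ − 1| + |g⁽ᵏ⁾(α_w θ) − g⁽ᵏ⁾(t)|` (`k ≤ 4`), its
RATE form `… + a_{k+1}·|⟨α_w(θ) − t⟩|` for `k ≤ 3`, its NO-RATE form `… + 2·a_k` for `k ≤ 4`, and `|g(α_w θ) − g(t)| ≤ a₁·|⟨α_w(θ) − t⟩|`;
here `X_w = certAngleJets r w θ` and `⟨·⟩` is the representative in `(−π, π]`. -/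
theorem ae_jmeas_chain_bounds_certAngle_C4 (hr : ContDiff ℝ 4 r) (hg : ContDiff ℝ 4 g) (hper : Function.Periodic g (2 * π))
    (ha : ∀ l, 1 ≤ l → l ≤ 4 → ∀ x, |iteratedDeriv l g x| ≤ a l) (θ : ℝ) :
    ∀ᵐ w ∂jmeas, ContDiffAt ℝ 4 (fun ϑ : ℝ => g (certAngle r w ϑ)) θ ∧
      (∀ k, 1 ≤ k → k ≤ 4 →
        |iteratedDeriv k (fun ϑ : ℝ => g (certAngle r w ϑ)) θ| ≤ ∑ l ∈ Finset.Icc 1 k, a l * bellP k l (certAngleJets r w θ)) ∧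
      (∀ k, 1 ≤ k → k ≤ 4 → ∀ t : ℝ,
        |iteratedDeriv k (fun ϑ : ℝ => g (certAngle r w ϑ)) θ - iteratedDeriv k g t| ≤
          (∑ l ∈ Finset.Ico 1 k, a l * bellP k l (certAngleJets r w θ)) + a k * |iteratedDeriv 1 (certAngle r w) θ ^ k - 1| +
            |iteratedDeriv k g (certAngle r w θ) - iteratedDeriv k g t|) ∧
      (∀ k, 1 ≤ k → k ≤ 3 → ∀ t : ℝ,
        |iteratedDeriv k (fun ϑ : ℝ => g (certAngle r w ϑ)) θ - iteratedDeriv k g t| ≤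
          (∑ l ∈ Finset.Ico 1 k, a l * bellP k l (certAngleJets r w θ)) + a k * |iteratedDeriv 1 (certAngle r w) θ ^ k - 1| +
            a (k + 1) * |toIocMod Real.two_pi_pos (-π) (certAngle r w θ - t)|) ∧
      (∀ k, 1 ≤ k → k ≤ 4 → ∀ t : ℝ,
        |iteratedDeriv k (fun ϑ : ℝ => g (certAngle r w ϑ)) θ - iteratedDeriv k g t| ≤
          (∑ l ∈ Finset.Ico 1 k, a l * bellP k l (certAngleJets r w θ)) + a k * |iteratedDeriv 1 (certAngle r w) θ ^ k - 1| +
            2 * a k) ∧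
      (∀ t : ℝ, |g (certAngle r w θ) - g t| ≤ a 1 * |toIocMod Real.two_pi_pos (-π) (certAngle r w θ - t)|) := by
  refine (ae_jmeas_contDiffAt_certAngle hr θ).mono fun w hw => ?_
  -- an open chart around `θ` on which the displaced angle is `C⁴`
  obtain ⟨u, u_open, hθu, hu⟩ := hw.contDiffOn' le_rfl (by simp)
  have hU : ContDiffOn ℝ 4 (certAngle r w) u := hu.mono fun x hx => ⟨Set.mem_insert_of_mem _ (Set.mem_univ _), hx⟩
  have hraw : ∀ k, 1 ≤ k → k ≤ 4 → ∀ t : ℝ,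
      |iteratedDeriv k (fun ϑ : ℝ => g (certAngle r w ϑ)) θ - iteratedDeriv k g t| ≤
        (∑ l ∈ Finset.Ico 1 k, a l * bellP k l (certAngleJets r w θ)) + a k * |iteratedDeriv 1 (certAngle r w) θ ^ k - 1| +
          |iteratedDeriv k g (certAngle r w θ) - iteratedDeriv k g t| := fun k hk1 hk t =>
    abs_iteratedDeriv_comp_sub_ref_le u_open hg hU hθu ha hk1 hk t
  refine ⟨?_, ?_, hraw, ?_, ?_, ?_⟩
  · exact ContDiffAt.comp θ hg.contDiffAt hw
  · intro k hk1 hk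
    exact abs_iteratedDeriv_comp_le_bellP u_open hg hU hθu ha hk1 hk
  · intro k hk1 hk t
    have hk4 : ((k + 1 : ℕ) : WithTop ℕ∞) ≤ 4 := by exact_mod_cast Nat.succ_le_of_lt (Nat.lt_of_le_of_lt hk (by norm_num))
    have hinc : |iteratedDeriv k g (certAngle r w θ) - iteratedDeriv k g t| ≤ a (k + 1) * |toIocMod Real.two_pi_pos (-π) (certAngle r w θ - t)| :=
      abs_iteratedDeriv_sub_le_of_periodic (hg.of_le hk4) hper (ha (k + 1) (Nat.le_add_left 1 k) (by omega)) _ _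
    exact (hraw k hk1 (hk.trans (by norm_num)) t).trans (add_le_add le_rfl hinc)
  · intro k hk1 hk t
    have h1 := ha k hk1 hk (certAngle r w θ)
    have h2 := ha k hk1 hk t
    have hinc : |iteratedDeriv k g (certAngle r w θ) - iteratedDeriv k g t| ≤ 2 * a k := by
      refine (abs_sub _ _).trans ?_
      linarith
    exact (hraw k hk1 hk t).trans (add_le_add le_rfl hinc)
  · intro t
    have h := abs_iteratedDeriv_sub_le_of_periodic (k := 0) (hg.of_le (by norm_num)) hper (ha 1 le_rfl (by norm_num)) (certAngle r w θ) t
    simpa only [iteratedDeriv_zero] using h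

end ChainAE

/-! ## §2 The majorant form at one base angle, `C⁴` history -/

section Majorants

variable {L M : ℕ} [NeZero L] [NeZero M]

/-- **Jets of the Jackson remainder from certificate majorants at one base angle, `C⁴` history, ABSTRACT top increment** (the assembly core):
the top-order transport increment is charged by any a.e. majorant `ι` of `|χ_w(θ)|·|g⁽ᵏ⁾(α_w θ) − g⁽ᵏ⁾(θ)|` with `∫J̃J̃·ι ≤ I`; the bound is the
door's sum with transport moment `Σ_{l<k} a_l·Tt[k,l] + a_k·Tu[k] + I` (`1 ≤ k ≤ 4`). -/
theorem flowPiece_reading_remainder_jets_of_majorants_top (T : CutoffDefectTable) (β U : ℝ) {μ : ℝ} (hμ : μ ∈ klWindowC) (n : ℕ)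
    (K' : TrigPolyC4v)
    (hf : ContDiff ℝ 4 fun θ : ℝ => klLocalPart L M β U μ (klFlowFrameU L M β U μ n) n θ)
    (hon : ∀ θ, klFrameExtFn μ (fun θ => klLocalPart L M β U μ (klFlowFrameU L M β U μ n) n θ) (klFermiPoint μ K' θ) =
      klLocalPart L M β U μ (klFlowFrameU L M β U μ n) n θ)
    (hang : ∀ θ, klLocalPart L M β U μ (klFlowFrameU L M β U μ n) n (polarAngle (centredRep (klFermiPoint μ K' θ))) =
      klLocalPart L M β U μ (klFlowFrameU L M β U μ n) n θ)
    {a : ℕ → ℝ} (ha_nn : ∀ l, 0 ≤ a l)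
    (ha0 : ∀ x, |klLocalPart L M β U μ (klFlowFrameU L M β U μ n) n x -
      klAngularMean (fun θ => klLocalPart L M β U μ (klFlowFrameU L M β U μ n) n θ)| ≤ a 0)
    (ha : ∀ l, 1 ≤ l → l ≤ 4 → ∀ x, |iteratedDeriv l (fun x => klLocalPart L M β U μ (klFlowFrameU L M β U μ n) n x -
      klAngularMean (fun θ => klLocalPart L M β U μ (klFlowFrameU L M β U μ n) n θ)) x| ≤ a l)
    (hr : ContDiff ℝ 4 (perturbedFermiRadius (fun p => -K'.eval p) μ))
    (hflat : ∀ ϑ : ℝ, klFlatCutoffFn μ (klFermiPoint μ K' ϑ) = 1)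
    {k : ℕ} (hk1 : 1 ≤ k) (hk : k ≤ 4) (θ : ℝ)
    (hex : ∃ (nq : ℕ → ℝ × ℝ → ℝ) (mq : ℕ → ℕ → ℕ → ℝ × ℝ → ℝ) (tq : ℕ → ℕ → ℝ × ℝ → ℝ) (uq : ℕ → ℝ × ℝ → ℝ) (dq : ℝ × ℝ → ℝ),
      (∀ i, Integrable (fun w => jweight (klFlowDeg n) w * nq i w) jmeas) ∧
      (∀ k i l, Integrable (fun w => jweight (klFlowDeg n) w * mq k i l w) jmeas) ∧
      (∀ k l, Integrable (fun w => jweight (klFlowDeg n) w * tq k l w) jmeas) ∧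
      (∀ k, Integrable (fun w => jweight (klFlowDeg n) w * uq k w) jmeas) ∧
      Integrable (fun w => jweight (klFlowDeg n) w * dq w) jmeas ∧
      (∀ᵐ w ∂jmeas,
        |certCutoff μ (perturbedFermiRadius (fun p => -K'.eval p) μ) w θ - 1| ≤ nq 0 w ∧
        (∀ i, 1 ≤ i → i ≤ 4 → |iteratedDeriv i (certCutoff μ (perturbedFermiRadius (fun p => -K'.eval p) μ) w) θ| ≤ nq i w) ∧
        (∀ k i l, 1 ≤ i → i < k → k ≤ 4 → 1 ≤ l → l ≤ k - i →
          |iteratedDeriv i (certCutoff μ (perturbedFermiRadius (fun p => -K'.eval p) μ) w) θ| *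
            bellP (k - i) l (certAngleJets (perturbedFermiRadius (fun p => -K'.eval p) μ) w θ) ≤ mq k i l w) ∧
        (∀ k l, 1 ≤ l → l < k → k ≤ 4 →
          |certCutoff μ (perturbedFermiRadius (fun p => -K'.eval p) μ) w θ| *
            bellP k l (certAngleJets (perturbedFermiRadius (fun p => -K'.eval p) μ) w θ) ≤ tq k l w) ∧
        (∀ k, 1 ≤ k → k ≤ 4 →
          |certCutoff μ (perturbedFermiRadius (fun p => -K'.eval p) μ) w θ| *
            |iteratedDeriv 1 (certAngle (perturbedFermiRadius (fun p => -K'.eval p) μ) w) θ ^ k - 1| ≤ uq k w) ∧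
        |certCutoff μ (perturbedFermiRadius (fun p => -K'.eval p) μ) w θ| *
          |toIocMod Real.two_pi_pos (-π) (certAngle (perturbedFermiRadius (fun p => -K'.eval p) μ) w θ - θ)| ≤ dq w) ∧
      (∫ w, jweight (klFlowDeg n) w * nq 0 w ∂jmeas ≤ T.N0) ∧
      (∀ i, 1 ≤ i → i ≤ 4 → ∫ w, jweight (klFlowDeg n) w * nq i w ∂jmeas ≤ T.N i) ∧
      (∀ k i l, 1 ≤ i → i < k → k ≤ 4 → 1 ≤ l → l ≤ k - i → ∫ w, jweight (klFlowDeg n) w * mq k i l w ∂jmeas ≤ T.Mc k i l) ∧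
      (∀ k l, 1 ≤ l → l < k → k ≤ 4 → ∫ w, jweight (klFlowDeg n) w * tq k l w ∂jmeas ≤ T.Tt k l) ∧
      (∀ k, 1 ≤ k → k ≤ 4 → ∫ w, jweight (klFlowDeg n) w * uq k w ∂jmeas ≤ T.Tu k) ∧
      (∫ w, jweight (klFlowDeg n) w * dq w ∂jmeas ≤ T.Td))
    {ι : ℝ × ℝ → ℝ} (hιint : Integrable (fun w => jweight (klFlowDeg n) w * ι w) jmeas) {I : ℝ}
    (hιI : ∫ w, jweight (klFlowDeg n) w * ι w ∂jmeas ≤ I)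
    (hinc : ∀ᵐ w ∂jmeas,
      |certCutoff μ (perturbedFermiRadius (fun p => -K'.eval p) μ) w θ| *
        |iteratedDeriv k (fun x => klLocalPart L M β U μ (klFlowFrameU L M β U μ n) n x -
              klAngularMean (fun θ => klLocalPart L M β U μ (klFlowFrameU L M β U μ n) n θ))
            (certAngle (perturbedFermiRadius (fun p => -K'.eval p) μ) w θ) -
          iteratedDeriv k (fun x => klLocalPart L M β U μ (klFlowFrameU L M β U μ n) n x -
              klAngularMean (fun θ => klLocalPart L M β U μ (klFlowFrameU L M β U μ n) n θ)) θ| ≤ ι w) :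
    |iteratedDeriv k (fun θ => klLocalPart L M β U μ (klFlowFrameU L M β U μ n) n θ -
        (klFlowPiece L M β U μ n).eval (klFermiPoint μ K' θ)) θ| ≤
      (∑ i ∈ Finset.range k, ((k.choose (i + 1) : ℕ) : ℝ) *
          ((if i + 1 = k then a 0 * T.N (i + 1) else 0) + ∑ l ∈ Finset.Icc 1 (k - (i + 1)), a l * T.Mc k (i + 1) l)) +
        ((∑ l ∈ Finset.Ico 1 k, a l * T.Tt k l) + a k * T.Tu k + I) + a k * T.N0 := by
  set f : ℝ → ℝ := fun θ => klLocalPart L M β U μ (klFlowFrameU L M β U μ n) n θ with hfdef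
  set m : ℝ := klAngularMean f with hmdef
  set g : ℝ → ℝ := fun x => f x - m with hgdef
  set r : ℝ → ℝ := perturbedFermiRadius (fun p => -K'.eval p) μ with hrdef
  have hper : Function.Periodic f (2 * Real.pi) := klLocalPart_periodic β U μ _ n
  have hgper : Function.Periodic g (2 * Real.pi) := fun x => by simp only [hgdef, hper x]
  have hg4 : ContDiff ℝ 4 g := hf.sub contDiff_const
  have hγ : ContDiff ℝ 4 fun θ => (WithLp.toLp 2 (klFermiPoint μ K' θ) : EuclideanSpace ℝ (Fin 2)) := contDiff_certCurve hr
  obtain ⟨nq, mq, tq, uq, dq, hin, him, hit, hiu, -, hae, hN0, hN, hMc, hTt, hTu, -⟩ := hex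
  -- the a.e. chain bounds of the displaced angular factor (`C⁴` profile)
  have hchain := ae_jmeas_chain_bounds_certAngle_C4 hr hg4 hgper ha θ
  -- majorants
  set pdef : ℕ → ℝ × ℝ → ℝ := fun i w => (if i = k then a 0 * nq i w else 0) + ∑ l ∈ Finset.Icc 1 (k - i), a l * mq k i l w with hpdef
  set tdef : ℝ × ℝ → ℝ := fun w => (∑ l ∈ Finset.Ico 1 k, a l * tq k l w) + a k * uq k w + ι w with htdef
  set edef : ℝ × ℝ → ℝ := fun w => a k * nq 0 w with hedef
  -- integrability
  have epdef : ∀ i w, jweight (klFlowDeg n) w * pdef i w =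
      (if i = k then a 0 * (jweight (klFlowDeg n) w * nq i w) else 0) +
        ∑ l ∈ Finset.Icc 1 (k - i), a l * (jweight (klFlowDeg n) w * mq k i l w) := by
    intro i w
    by_cases hieq : i = k
    · simp only [hpdef, hieq, if_true, mul_add, Finset.mul_sum]
      congr 1
      · ring
      · exact Finset.sum_congr rfl fun l _ => by ring
    · simp only [hpdef, hieq, if_false, zero_add, Finset.mul_sum]
      exact Finset.sum_congr rfl fun l _ => by ring
  have hpint : ∀ i, 1 ≤ i → i ≤ k → Integrable (fun w => jweight (klFlowDeg n) w * pdef i w) jmeas := by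
    intro i hi1 hik
    have e : (fun w => jweight (klFlowDeg n) w * pdef i w) =
        fun w => (if i = k then a 0 * (jweight (klFlowDeg n) w * nq i w) else 0) +
          ∑ l ∈ Finset.Icc 1 (k - i), a l * (jweight (klFlowDeg n) w * mq k i l w) := funext (epdef i)
    rw [e]
    refine Integrable.add ?_ (integrable_finsetSum _ fun l _ => (him k i l).const_mul _)
    by_cases hieq : i = k
    · simp only [hieq, if_true]; exact (hin k).const_mul _
    · simp only [hieq, if_false]; exact integrable_zero _ _ _
  have etdef : (fun w => jweight (klFlowDeg n) w * tdef w) =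
      fun w => (∑ l ∈ Finset.Ico 1 k, a l * (jweight (klFlowDeg n) w * tq k l w)) + a k * (jweight (klFlowDeg n) w * uq k w) +
        jweight (klFlowDeg n) w * ι w := by
    funext w; simp only [htdef, mul_add, Finset.mul_sum]; ring_nf
  have htint : Integrable (fun w => jweight (klFlowDeg n) w * tdef w) jmeas := by
    rw [etdef]
    exact ((integrable_finsetSum _ fun l _ => (hit k l).const_mul _).add ((hiu k).const_mul _)).add hιint
  have heint : Integrable (fun w => jweight (klFlowDeg n) w * edef w) jmeas := by
    have e : (fun w => jweight (klFlowDeg n) w * edef w) = fun w => a k * (jweight (klFlowDeg n) w * nq 0 w) := by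
      funext w; simp only [hedef]; ring
    rw [e]; exact (hin 0).const_mul _
  -- moments
  have hMx : ∀ i, 1 ≤ i → i ≤ k → ∫ w, jweight (klFlowDeg n) w * pdef i w ∂jmeas ≤
      (if i = k then a 0 * T.N i else 0) + ∑ l ∈ Finset.Icc 1 (k - i), a l * T.Mc k i l := by
    intro i hi1 hik
    have hsum : ∫ w, ∑ l ∈ Finset.Icc 1 (k - i), a l * (jweight (klFlowDeg n) w * mq k i l w) ∂jmeas ≤
        ∑ l ∈ Finset.Icc 1 (k - i), a l * T.Mc k i l := by
      rw [integral_finsetSum _ fun l _ => (him k i l).const_mul _]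
      refine Finset.sum_le_sum fun l hl => ?_
      rw [integral_const_mul]
      simp only [Finset.mem_Icc] at hl
      have hlt : i < k := by omega
      exact mul_le_mul_of_nonneg_left (hMc k i l hi1 hlt hk hl.1 hl.2) (ha_nn l)
    have i2 : Integrable (fun w => ∑ l ∈ Finset.Icc 1 (k - i), a l * (jweight (klFlowDeg n) w * mq k i l w)) jmeas :=
      integrable_finsetSum _ fun l _ => (him k i l).const_mul _
    by_cases hieq : i = k
    · have e : (fun w => jweight (klFlowDeg n) w * pdef i w) =
          fun w => a 0 * (jweight (klFlowDeg n) w * nq i w) + ∑ l ∈ Finset.Icc 1 (k - i), a l * (jweight (klFlowDeg n) w * mq k i l w) := by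
        funext w; rw [epdef i w]; simp only [hieq, if_true]
      have i1 : Integrable (fun w => a 0 * (jweight (klFlowDeg n) w * nq i w)) jmeas := (hin i).const_mul _
      rw [e, integral_add i1 i2, integral_const_mul]
      simp only [hieq, if_true]
      refine add_le_add (mul_le_mul_of_nonneg_left (hN k hk1 hk) (ha_nn 0)) ?_
      rw [hieq] at hsum; exact hsum
    · have e : (fun w => jweight (klFlowDeg n) w * pdef i w) =
          fun w => ∑ l ∈ Finset.Icc 1 (k - i), a l * (jweight (klFlowDeg n) w * mq k i l w) := by
        funext w; rw [epdef i w]; simp only [hieq, if_false, zero_add]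
      rw [e]
      simp only [hieq, if_false, zero_add]
      exact hsum
  have hTm : ∫ w, jweight (klFlowDeg n) w * tdef w ∂jmeas ≤ (∑ l ∈ Finset.Ico 1 k, a l * T.Tt k l) + a k * T.Tu k + I := by
    have i1 : Integrable (fun w => ∑ l ∈ Finset.Ico 1 k, a l * (jweight (klFlowDeg n) w * tq k l w)) jmeas :=
      integrable_finsetSum _ fun l _ => (hit k l).const_mul _
    have i2 : Integrable (fun w => a k * (jweight (klFlowDeg n) w * uq k w)) jmeas := (hiu k).const_mul _
    have i12 : Integrable (fun w => (∑ l ∈ Finset.Ico 1 k, a l * (jweight (klFlowDeg n) w * tq k l w)) +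
        a k * (jweight (klFlowDeg n) w * uq k w)) jmeas := i1.add i2
    rw [etdef, integral_add i12 hιint, integral_add i1 i2, integral_const_mul,
      integral_finsetSum _ fun l _ => (hit k l).const_mul _]
    refine add_le_add (add_le_add (Finset.sum_le_sum fun l hl => ?_) (mul_le_mul_of_nonneg_left (hTu k hk1 hk) (ha_nn k))) hιI
    rw [integral_const_mul]
    simp only [Finset.mem_Ico] at hl
    exact mul_le_mul_of_nonneg_left (hTt k l hl.1 hl.2 hk) (ha_nn l)
  have hEm : ∫ w, jweight (klFlowDeg n) w * edef w ∂jmeas ≤ a k * T.N0 := by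
    have e : (fun w => jweight (klFlowDeg n) w * edef w) = fun w => a k * (jweight (klFlowDeg n) w * nq 0 w) := by
      funext w; simp only [hedef]; ring
    rw [e, integral_const_mul]
    exact mul_le_mul_of_nonneg_left hN0 (ha_nn k)
  -- the a.e. product / transport / defect majorisations
  have hak : ∀ x, |iteratedDeriv k g x| ≤ a k := ha k hk1 hk
  have hw : ∀ᵐ w ∂jmeas,
      (∀ i, 1 ≤ i → i ≤ k →
        |iteratedDeriv i (fun ϑ : ℝ =>
            klFlatCutoffFn μ (WithLp.ofLp ((WithLp.toLp 2 (klFermiPoint μ K' ϑ) : EuclideanSpace ℝ (Fin 2)) - jshift w))) θ| *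
          |iteratedDeriv (k - i) (fun ϑ : ℝ =>
            f (polarAngle (centredRep (WithLp.ofLp ((WithLp.toLp 2 (klFermiPoint μ K' ϑ) : EuclideanSpace ℝ (Fin 2)) - jshift w)))) -
              klAngularMean f) θ| ≤ pdef i w) ∧
      |klFlatCutoffFn μ (WithLp.ofLp ((WithLp.toLp 2 (klFermiPoint μ K' θ) : EuclideanSpace ℝ (Fin 2)) - jshift w))| *
        |iteratedDeriv k (fun ϑ : ℝ =>
            f (polarAngle (centredRep (WithLp.ofLp ((WithLp.toLp 2 (klFermiPoint μ K' ϑ) : EuclideanSpace ℝ (Fin 2)) - jshift w)))) -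
              klAngularMean f) θ -
          iteratedDeriv k (fun ϑ : ℝ => f ϑ - klAngularMean f) θ| ≤ tdef w ∧
      |klFlatCutoffFn μ (WithLp.ofLp ((WithLp.toLp 2 (klFermiPoint μ K' θ) : EuclideanSpace ℝ (Fin 2)) - jshift w)) - 1| *
        |iteratedDeriv k (fun ϑ : ℝ => f ϑ - klAngularMean f) θ| ≤ edef w := by
    filter_upwards [hae, hchain, hinc] with w h1 h2 h3
    obtain ⟨hnq0, hnq, hmq, htq, huq, -⟩ := h1
    obtain ⟨-, hgr, htr, -, -, -⟩ := h2
    -- the door's expressions are the certificate's objects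
    have ecut : (fun ϑ : ℝ => klFlatCutoffFn μ (WithLp.ofLp ((WithLp.toLp 2 (klFermiPoint μ K' ϑ) : EuclideanSpace ℝ (Fin 2)) - jshift w))) =
        certCutoff μ r w := by funext ϑ; rfl
    have eang : (fun ϑ : ℝ => f (polarAngle (centredRep (WithLp.ofLp ((WithLp.toLp 2 (klFermiPoint μ K' ϑ) : EuclideanSpace ℝ (Fin 2)) - jshift w)))) -
        klAngularMean f) = fun ϑ => g (certAngle r w ϑ) := by funext ϑ; rfl
    have ecut0 : klFlatCutoffFn μ (WithLp.ofLp ((WithLp.toLp 2 (klFermiPoint μ K' θ) : EuclideanSpace ℝ (Fin 2)) - jshift w)) = certCutoff μ r w θ := rfl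
    have eg : (fun ϑ : ℝ => f ϑ - klAngularMean f) = g := rfl
    rw [ecut, eang, ecut0, eg]
    refine ⟨?_, ?_, ?_⟩
    · intro i hi1 hik
      by_cases hieq : i = k
      · -- top order: the angular factor enters by its value only
        subst hieq
        have e0 : Finset.Icc 1 (i - i) = ∅ := by rw [Nat.sub_self]; decide
        simp only [hpdef, if_true, e0, Finset.sum_empty, add_zero]
        rw [Nat.sub_self, iteratedDeriv_zero]
        calc |iteratedDeriv i (certCutoff μ r w) θ| * |g (certAngle r w θ)| ≤ nq i w * a 0 :=
              mul_le_mul (hnq i hi1 hk) (ha0 _) (abs_nonneg _) ((abs_nonneg _).trans (hnq i hi1 hk))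
          _ = a 0 * nq i w := mul_comm _ _
      · have hlt : i < k := lt_of_le_of_ne hik hieq
        have hki1 : 1 ≤ k - i := by omega
        have hki4 : k - i ≤ 4 := by omega
        have hg' := hgr (k - i) hki1 hki4
        simp only [hpdef, hieq, if_false, zero_add]
        calc |iteratedDeriv i (certCutoff μ r w) θ| * |iteratedDeriv (k - i) (fun ϑ => g (certAngle r w ϑ)) θ|
            ≤ |iteratedDeriv i (certCutoff μ r w) θ| * ∑ l ∈ Finset.Icc 1 (k - i), a l * bellP (k - i) l (certAngleJets r w θ) :=
              mul_le_mul_of_nonneg_left hg' (abs_nonneg _)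
          _ = ∑ l ∈ Finset.Icc 1 (k - i), a l * (|iteratedDeriv i (certCutoff μ r w) θ| * bellP (k - i) l (certAngleJets r w θ)) := by
              rw [Finset.mul_sum]; refine Finset.sum_congr rfl fun l _ => ?_; ring
          _ ≤ ∑ l ∈ Finset.Icc 1 (k - i), a l * mq k i l w := Finset.sum_le_sum fun l hl => by
              simp only [Finset.mem_Icc] at hl
              exact mul_le_mul_of_nonneg_left (hmq k i l hi1 hlt hk hl.1 hl.2) (ha_nn l)
    · -- transport, the top increment charged by `ι`
      have h := htr k hk1 hk θ
      have hχ0 : 0 ≤ |certCutoff μ r w θ| := abs_nonneg _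
      calc |certCutoff μ r w θ| * |iteratedDeriv k (fun ϑ => g (certAngle r w ϑ)) θ - iteratedDeriv k g θ|
          ≤ |certCutoff μ r w θ| * ((∑ l ∈ Finset.Ico 1 k, a l * bellP k l (certAngleJets r w θ)) +
              a k * |iteratedDeriv 1 (certAngle r w) θ ^ k - 1| + |iteratedDeriv k g (certAngle r w θ) - iteratedDeriv k g θ|) :=
            mul_le_mul_of_nonneg_left h hχ0
        _ = (∑ l ∈ Finset.Ico 1 k, a l * (|certCutoff μ r w θ| * bellP k l (certAngleJets r w θ))) +
              a k * (|certCutoff μ r w θ| * |iteratedDeriv 1 (certAngle r w) θ ^ k - 1|) +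
              |certCutoff μ r w θ| * |iteratedDeriv k g (certAngle r w θ) - iteratedDeriv k g θ| := by
            rw [mul_add, mul_add, Finset.mul_sum]; congr 1; congr 1
            · refine Finset.sum_congr rfl fun l _ => ?_; ring
            · ring
        _ ≤ tdef w := by
            simp only [htdef]
            refine add_le_add (add_le_add (Finset.sum_le_sum fun l hl => ?_) (mul_le_mul_of_nonneg_left (huq k hk1 hk) (ha_nn k))) h3
            simp only [Finset.mem_Ico] at hl
            exact mul_le_mul_of_nonneg_left (htq k l hl.1 hl.2 hk) (ha_nn l)
    · -- defect
      simp only [hedef]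
      calc |certCutoff μ r w θ - 1| * |iteratedDeriv k g θ| ≤ nq 0 w * a k :=
            mul_le_mul hnq0 (hak θ) (abs_nonneg _) ((abs_nonneg _).trans hnq0)
        _ = a k * nq 0 w := mul_comm _ _
  have hmain := flowPiece_reading_remainder_jets_weightedMoments_ae (L := L) (M := M) β U hμ n K' hf hon hang hγ hflat hk θ
    hpint htint heint hw hMx hTm hEm
  exact hmain

end Majorants

end Summit.HubbardSuperconductivity.HubbardSuperconductivity.Theorems.KLRegimeSplit

end
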